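import Mathlib
import HarnessLib
import HarnessLib.Audit
import Summits.HubbardSuperconductivity.Statement
import Literature.MathematicalPhysics.QuantumLattice.HeisenbergModel
import HarnessLib.Audit.Status.Attr

/-!
Route: LevyLogBootstrap

DORMANT since 2026-08-26T09:38:07Z (reconciler: no traction for 8.4 d (last activity item-evidence-added at 2026-08-17T23:17:33Z); parked, not closed — `ledger route dormant route-HubbardSuperconductivity-LevyLogBootstrap --off` to reac) — unstaffed, not closed; items shared with open routes are served there. `ledger route dormant <id> --off` reactivates.

# Route LevyLogBootstrap — take logarithms — Lévy mass of the 2×2-block transverse kernel closes the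
KLS infrared bound on all of Δ∈(−1,0], then plaquette dress + continue

X := Block2InfDivXXZ ∧ LevyTransport ∧ DressHalfFilled ∧ Continuation ("it suffices to show X";
realises card levy-mass-log-bootstrap,
critic-graded new-mechanism, filed by planner-mechhunt-…-2272-10-0 and CREDITED; the summit leg is
the plaquette dictionary of
plaquette-boson-kls-anchor shared by signature with routes PlaquetteBoson / AnisotropyChord).
Conventions of those routes: H_M(Δ) =
xxzHamiltonian 1 (torusGraph 2 M) (−1) Δ = −Σ(SˣSˣ+SʸSʸ+ΔSᶻSᶻ) on the even torus (ℤ/Mℤ)² (hard-core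
bosons, n.n. repulsion −Δ), half-filled
sector S^z_tot = 0 (unique ground state by Perron–Frobenius, so the transverse kernel K(x,y) =
Re⟨ψ,S⁺_xS⁻_yψ⟩ is entrywise POSITIVE and
translation invariant). NEW OBJECT: the 2×2-BLOCK kernel K₂(X,Y) = Σ_{x∈B_X,y∈B_Y} K(x,y) on the
coarse torus (ℤ/(M/2))², φ := −log(K₂/K₂(0)),
and — when K₂ is INFINITELY DIVISIBLE (all fractional Hadamard powers PSD ⇔ φ of negative type ⇔
Lévy–Khintchine φ(X) = Σ_{k≠0} ν_k(1−cos k·X),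
ν ≥ 0) — its LÉVY MASS |ν| = mean_X φ. Exact consequences: condensate fraction f = K̂₂(0)/(n²K₂(0))
= P(S=0) ≥ e^{−|ν|} for the compound-Poisson
momentum walk S with intensities ν (Jensen; support LevyJensenFloor is the ν-free form), Goldstone
wing ν_k ≤ e^{|ν|}K̂₂(k)/(n²K₂(0)), UV mass
Σ_{|k|≥κ}ν_k ≤ (φ(e₁)+φ(e₂))/c_κ. (K1 = Block2InfDivXXZ, rank 2) K₂ is infinitely divisible for
every even M ≥ 4, every Δ ∈ [−1,0]. (K2 =
LevyTransport, rank 3) K1 ⇒ HalfFilledOrder (planar order ≥ c(Δ)M⁴ of every half-filled sector GS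
for every Δ ∈ (−1,0], in particular the
plaquette lock-in Δ_eff(U) ≈ −0.99) by the LOG-BOOTSTRAP: at every Δ, |ν| ≤ U_κ + β_κe^{|ν|} with
U_κ from LOCAL n.n. block log-coherence
and β_κ := Σ_{0<|k|<κ}K̂₂(k)/(n²K₂(0)) from the reflection-positivity infrared bound (Gaussian
domination, available on the whole AF side
Δ ∈ [−1,0]); if β_κe^{U_κ+1} < 1 the value |ν| = U_κ+1 is FORBIDDEN uniformly in M, so fixed-M
continuity of |ν|(Δ) from the KLS point
(|ν|(0) ≤ U_κ+1 by a pointwise KLS anchor) gives f(Δ) ≥ e^{−U_κ−1} on all of [−1,0]. (K3 =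
DressHalfFilled, rank 4, stmt-8148) half-filled
planar order at every Δ ∈ (−1,0] ⇒ every-GS d_{x²−y²} pair-field order of the checkerboard Hubbard
torus at δ = 1/4, small t'. (K4 =
Continuation, rank 5, stmt-0907) continue t' ↑ 1 to hubbardTorus 2 L 1 U.
Lean: `Block2InfDivXXZ ∧ LevyTransport ∧ DressHalfFilled ∧ Continuation`

## Assembly
Pure logic (theorem `closes` in glue.lean; sorry-free, lean check rc 0 in Sketch.lean together with
`assembly_proof : Assembly`):
LevyTransport applied to Block2InfDivXXZ is HalfFilledOrder, whose body is literally the antecedent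
of DressHalfFilled; DressHalfFilled returns
U > 0, δ ∈ (0,1/2) and the small-t' anchor data ⟨t₀,…⟩, and Continuation U δ turns those into the
summit's conclusion at (U,δ), which with
⟨U, hU, δ, hδ, …⟩ is HubbardSuperconductivity (= Literature.Hubbard.DWaveSuperconductivityHubbard by
Iff.rfl). HalfFilledOrder and
LevyJensenFloor do not enter `closes` (hub decl / provable toolkit).

Rationale: WHY THIS LINE. Every Kennedy–Lieb–Shastry-type proof of ground-state U(1) order in d = 2 closes a
LINEAR sum rule against the infrared bound and
therefore has an O(1) THRESHOLD: the S=½ XXZ pair gas closes only for |Δ| ≲ 0.13–0.2 (KLS1988PRL,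
KuboKishi1988, doi:10.1007/bf01042599)
while the plaquette dictionary (YaoTsaiKivelson2007, TsaiKivelson2006; routes
PlaquetteBoson/AnisotropyChord/PolyaSchurPairBoson) needs
Δ_eff ≈ −0.99 — the recorded "sum-rule ceiling". Taking LOGARITHMS moves the problem into harmonic
analysis on the finite abelian group
(ℤ/n)² (Schoenberg1938, Bhatia2006, BergChristensenRessel1984 ch. 3–4): for an infinitely divisible
kernel the condensate enters only as the
additive budget |ν| = log(1/f) + O(1), the closure becomes a bootstrap with an L-uniform forbidden
gap (printed SHAPE of the move: Slade's
bootstrap lemma for the lace expansion, doi:10.1007/b128444 Lemma 5.9 — linear quantity, other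
problem), and the threshold becomes a BLOCK
SIZE (the n.n. block log-coherence Φ_b → 0 as b grows). Imported area: negative-type metrics /
Lévy–Khintchine on finite groups
(probability & metric embeddings) — no route of this sub uses it; the KLS infrared INPUT is kept,
only the CLOSURE is replaced. This seat's
deltas over the card: the load-bearing conjecture is placed on the 2×2-BLOCK kernel (the block form
factor (1+e^{ik₁})(1+e^{ik₂}) annihilates
EVERY mode with a π component, i.e. exactly the (π,π) checkerboard ringing that breaks the RAW
kernel's divisibility on the AF side and the
feared second harmonic (π,0); and b = 2 is the block size whose ED budget closes), the transport is
typed as one implication crux with its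
RP-side inputs named, and the summit leg is shared by signature (stmt-0906/8148/0907) so one proof
or refutation serves three routes.

RANKED CRUXES. #2 Block2InfDivXXZ (crux) — (card K1, block form) for every even M ≥ 4, every Δ ∈
[−1,0] and every normalised S^z_tot = 0 sector ground state ψ of H_M(Δ), the 2×2-block transverse
kernel K₂ (written as the M²×M² matrix (x,y) ↦ Σ_{x'∈block(x), y'∈block(y)} Re⟨ψ,S⁺_{x'}S⁻_{y'}ψ⟩,
block(x) = (⌊x₀/2⌋,⌊x₁/2⌋); its PSD/ID properties equal those of the coarse (M/2)²-matrix) has every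
fractional Hadamard power (entrywise t ↦ t^s, s ∈ (0,1]) positive semidefinite — infinite
divisibility; entries are > 0 by Perron–Frobenius, so real powers are genuine. [difficulty:
open-problem] (why it might fail: No positivity principle for the LOG of a ground-state correlation
is known beyond single axes (RP ⇒ axis-ID only); a ringing harmonic not killed by 2×2 blocks (e.g.
(π/2,π/2) structure near the AF point Δ→−1) could appear beyond 24 sites; literal all-M form tested
only on 4×4 (all fillings) and 6×4.) [Schoenberg1938, Bhatia2006, BergChristensenRessel1984,
doi:10.1103/physrevb.48.3264, KLS1988PRL,
idea:HubbardSuperconductivity/HubbardSuperconductivity/levy-mass-log-bootstrap]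
#3 LevyTransport (crux) — (card K2 in implication form) Block2InfDivXXZ ⇒ HalfFilledOrder: block
infinite divisibility on [−1,0] transports the planar order of the KLS point Δ = 0 to every Δ ∈
(−1,0] by the log-bootstrap |ν| ≤ U_κ + β_κe^{|ν|} — inputs: (a) Gaussian-domination infrared bound
K̂₂(k) ≤ B/|k|, 0<|k|<κ, for 2-block transverse fields uniformly on Δ ∈ [−1,0] (RP side: after the
sublattice π-rotation all three couplings are antiferromagnetic); (b) L-uniform lower bounds on n.n.
block transverse correlations (local; energy per bond); (c) a POINTWISE planar-order anchor min_X
K₂(X) ≥ c₀ at Δ = 0 uniformly in M; (d) β_κe^{U_κ+1} < 1 for some κ; then fixed-M continuity (unique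
GS, analytic in Δ) and the forbidden gap give f(Δ) ≥ e^{−U_κ−1}, i.e. ⟨S⁺_totS⁻_tot⟩ ≥
(e^{−U_κ−1}/8)·M⁴. [deps: Block2InfDivXXZ] [difficulty: XL] (why it might fail: Constants: the
card's ED budget at the KLS point closes only marginally for b=2 (≈0.9<1; b=4 comfortably) and
Φ₂(Δ), B(Δ) degrade toward Δ→−1, so b=2 may not close near Δ_eff≈−0.99 (then restate on 4×4 blocks);
input (c), pointwise order at the XY point, is expected (RP monotonicity) but unprinted.)
[KLS1988PRL, KLS1988JSP, DysonLiebSimon1978, KuboKishi1988, doi:10.1007/bf01042599,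
doi:10.1007/b128444, SandvikHamer1999]
#4 DressHalfFilled (crux) — (shared verbatim with AnisotropyChord
stmt-HubbardSuperconductivity-8148) DRESSING LEMMA at boson half filling: HalfFilledOrder (planar
order ≥ c(Δ)M⁴ of every half-filled sector GS of H_M(Δ), eventually in even M, for EVERY Δ ∈ (−1,0])
→ AnchorOrder (∃ U > 0, δ ∈ (0,1/2), t₀ > 0: for t' ∈ (0,t₀), eventually in L ∈ 4ℕ, every normalised
(N_L,0)-sector GS of the checkerboard torus hamiltonian(G_intra,1,U) + hamiltonian(G_inter,t',0),
N_L = 2⌊(1−δ)L²/2⌋, has Re⟨Δ_d†Δ_d⟩ ≥ c(t')L⁴); intended at δ = 1/4 with certified Δ_eff(U₀) ∈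
(−1,0], second-order Schrieffer–Wolff and a dressing lemma. [deps: LevyTransport] [difficulty: XL]
(why it might fail: Needs a U with CERTIFIED Δ_eff(U) = −V/2J ∈ (−1,0] (YTK: V/J<2 only for
U<U_s≈2.7; card ED −0.986…−0.993, 1% from the first-order d-CDW point); then gapless U(1) order of
H_XXZ(Δ_eff) must survive the O(t')-relative Schrieffer–Wolff remainder uniformly in L — stability
known for gapped phases only.) [YaoTsaiKivelson2007, TsaiKivelson2006,
doi:10.1103/physrevb.65.104508, BravyiHastingsMichalakis2010, AizenmanEtAl2004, KLS1988PRL]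
#5 Continuation (crux) — (shared verbatim with PlaquetteBoson/AnisotropyChord
stmt-HubbardSuperconductivity-0907) CONTINUATION t' → 1: for all U > 0, δ ∈ (0,1/2): [anchor-type
every-GS d-wave order ⟨Δ_d†Δ_d⟩ ≥ c(t')L⁴ on L ∈ 4ℕ tori for all t' ∈ (0,t₀)] ⇒ [the summit's
conclusion at (U,δ): every admissible ground-state sequence of hubbardTorus 2 L 1 U has
HasLongRangeOrder of torusPullback (pairFieldCorr dWaveFormFactor ψ) along even sides]. [deps:
DressHalfFilled] [difficulty: open-problem] (why it might fail: ∀(U,δ) implication with no tool (no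
continuity of GS order in t'∈(0,1]); expected FALSE where small-t' pair order exists but the uniform
GS is not d_{x²−y²}: U≤4, δ>0.4 (d_xy/p, DengEtAl2015), U≈6–8, δ≈1/8 (stripes, QinEtAl2020);
first-order d-CDW/PS on the t' path near U_s≈2.7.) [DengEtAl2015, QinEtAl2020, YaoTsaiKivelson2007,
doi:10.1103/physrevb.83.054508]
#9 HalfFilledOrder (support) — (shared verbatim with PlaquetteBoson/AnisotropyChord
stmt-HubbardSuperconductivity-0906; the hub the transport lands on) for every Δ ∈ (−1,0] there are
c(Δ) > 0, M₀ such that every normalised S^z_tot = 0 ground state ψ of xxzHamiltonian 1 (torusGraph 2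
M) (−1) Δ on even tori M ≥ M₀ has ⟨ψ, S⁺_tot S⁻_tot ψ⟩ ≥ c·M⁴ (known by RP + KLS closure only for
|Δ| ≲ 0.2). [difficulty: open-problem] [KLS1988PRL, KuboKishi1988, doi:10.1007/bf01042599]
#9 LevyJensenFloor (support) — (card P1, the ν-free "take logarithms" floor; provable now by
weighted AM–GM / convexity of exp) for every M and every entrywise-positive function k on the torus
(ℤ/Mℤ)²: exp(−M⁻²Σ_X log(k(0)/k(X))) ≤ (Σ_X k(X))/(M²·k(0)) — "condensate fraction ≥ e^{−Lévy
mass}"; the wing and UV-mass bounds (which need ν ≥ 0) ride later with --supports LevyTransport.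
[difficulty: provable-now] [BergChristensenRessel1984, Bhatia2006,
idea:HubbardSuperconductivity/HubbardSuperconductivity/levy-mass-log-bootstrap]

TWO-LAYER PLAN. Foreseen glued splits (not filed now): LevyTransport ⇐ BlockInfraredBound (GD for
2-block transverse fields, uniform on [−1,0]) →
PointwiseKLSAnchor (min_X K₂(X) ≥ c₀ at Δ = 0) → LevyTransport (the forbidden-gap calculus + fixed-M
continuity is the glue, with the
Lévy toolkit lemmas — wing bound, UV-mass bound, subgroup uniformity — riding as --supports);
Block2InfDivXXZ ⇐ AxisInfDiv (RP ⇒ ID along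
axes: transfer-matrix spectral representation ⇒ Hausdorff moment sequence ⇒ Pólya) →
OffAxisExtension → Block2InfDivXXZ; if b = 2 constants
fail near Δ_eff: add Block4InfDivXXZ (same statement on 4×4 blocks, M ∈ 8ℕ handled by the transport
at the nearest admissible block) and
restate the transport on it (one --restate, no new route).

KILL CRITERIA. (1) A half-filled XXZ ground state on an even torus (ED 6×6/8×4, or SSE/worm QMC ≥
8×8 confirmed by certified Lanczos on a subtorus) whose
2×2-block kernel has a NEGATIVE Lévy coefficient / a non-PSD fractional Hadamard power for some Δ ∈
[−1,0] ⇒ `refuted:Block2InfDivXXZ`;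
if the violation is a single removable harmonic, pivot once to Block4InfDivXXZ (restate), else close
the route (mechanism dead) and keep
LevyJensenFloor/toolkit as Literature. (2) Certified constants showing NO block size b ≤ 8 closes
(d) on [Δ_eff, 0] ⇒ LevyTransport's
mechanism is empty ⇒ close `exhausted` unless HalfFilledOrder is meanwhile proved elsewhere (then
this route is moot for the summit:
close `superseded --by` the proving route). (3) DressHalfFilled or Continuation refuted (shared) ⇒
close together with the sibling routes'
summit legs; Block2InfDivXXZ/LevyTransport survive as Literature targets (planar order of the S=½
XXZ model on all of (−1,0]).
(4) HalfFilledOrder proved by uv-ir LP (PlaquetteBoson) or by a chord (AnisotropyChord) ⇒ superseded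
for the summit.

NOT DECOMPOSED YET. The four inputs (a)–(d) of LevyTransport as separate items (layer 2, above); the
explicit constants κ, B(Δ), Φ₂(Δ), c₀ (certified
interval arithmetic on ≤ 24-site tori + the RP infrared constant); the sublattice (decimated)
variant of K1 (`SublatticeInfDivXXZ`, the
card's headline form with the same 57/57 ED support — either variant can feed a transport; only the
block form is filed to keep items
few); the electron tier of the card (ID_b of the blocked d-wave pair kernel of Hubbard ground states
+ a sub-κ IR bound — no RP input
exists there; honest bet, not an item); other boson fillings δ ≠ 1/4 (compose with
PbMonotoneDepletion if the continuation prefers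
another doping); every mechanism inside Continuation (the shared bet).

CHEAPEST FALSIFIER. Exact diagonalisation of the half-filled S^z_tot = 0 sector of H_M(Δ) on 6×6
(dim 9·10⁹ without symmetries; 2.5·10⁸ per momentum
sector) or 8×4, Δ ∈ {0, −0.25, −0.5, −0.75, −0.9, −1}: form the 2×2-block kernel on the 3×3 / 4×2
coarse torus, take entrywise powers
s ∈ {1/2, 1/4, 1/8, 1/16} (or the Lévy coefficients ν_k = inverse DFT of −log(K₂/K₂(0))) and look
for one negative eigenvalue / coefficient
(first suspects: Δ = −1, coarse k on the zone boundary). Already run by the card's author (kit jobs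
j004307/j004308, j004276/7): 4×4 at
every filling N = 2..8 and 6×4 at N = 12, 8, 4, each at six anisotropies — 57/57 block kernels ID
(margins 0.06–0.74), 57/57 decimated
kernels ID; the RAW kernel fails on the AF side (−Δ ≳ 0.3) through the single mode (π,π), which the
2×2 block form factor annihilates
exactly; classical XY Monte Carlo (j004292/3) all modes > 6σ positive; quasi-free fermion delimiter
(j004280–82): free Fermi gas never ID,
BCS kernels ID from block size b* = 2–8. This seat re-derived the (π,π)/(π,0) annihilation by the
block form factor on paper; no new job.

NUMBERS. m_xy(S=½ XY, d=2) = 0.437 ⇒ Λ/M⁴ → 0.191 at Δ = 0 (SandvikHamer1999); planar moment at Δ →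
−1⁺ ≈ (2/3)·0.307² share; n.n. transverse
correlation at the XY point ≈ 0.27 per bond (= −e₀/2, e₀ ≈ −0.549), so raw Φ = log(0.5/0.27) ≈ 0.6
per axis, card block sums: Φ_A ≈ 1.4
(decimated), Φ₂ ≈ 0.6 (2×2 blocks); IR coefficient ≈ 0.17κ; bootstrap margin β_κe^{U_κ+1} ≈ 0.9 at b
= 2, KLS point (card estimate,
uncertified). Proved easy-plane windows |Δ| < 0.13 (KuboKishi1988), ≈ 0.20 (doi:10.1007/bf01042599).
Plaquette lock-in Δ_eff(U) = −0.986
(U=1), −0.993 (U=2) (card plaquette-pseudospin-lockin, uncertified ED); pair-binding window U < U_c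
≈ 4.58, U_s ≈ 2.7. Items at open: 7
(4 cruxes, 2 supports, 1 assembly).

DEFINITION REQUESTS. None needed to type the items (infinite divisibility is written inline as PSD
of real Hadamard powers via Matrix.of / Matrix.PosSemidef /
Real.rpow). Nice-to-have, not filed: `IsInfDivKernel` / conditionally-negative-definite functions
and Lévy coefficients on ZMod n × ZMod n
beside Literature/…/MetricEmbeddings/CutCone.lean (card D1) — a prover may introduce it with
--supports.

Novelty: Searches (2026-08-16, this seat, on top of the card's audited list of 2026-08-15): `lit search
--hybrid "infinitely divisible matrix Hadamard power positive definite correlation"` (8 held books: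
Horn–Johnson, Bernstein, Bhatia-type pure matrix analysis; no physics); `lit search --hybrid "Levy
Khintchine negative definite function long range order spin"` (8, none on point); `lit search
--hybrid "Gaussian domination infrared bound block spin sum rule closure XXZ ground state planar
order"` (8; LSSY2005 p.117 = the RP/KLS closure itself); `lit search "infinitely divisible
correlation function lattice spin model" --source arxiv` (0); `lit galaxy search "infinitely
divisible matrices" --star all` (18: Bhatia 2006, Khare/Belton–Guillot–Khare–Putinar positivity
preservers, Berg–Christensen–Ressel — pure mathematics, no order-parameter use); `lit galaxy search
--star pdf "conditionally negative definite correlation"` (0); `lit frontier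
HubbardSuperconductivity --since 2024` (40 rows; nearest in spirit arXiv:2410.00810 symmetry
bootstrap = SDP certificates, linear; arXiv:2603.13212 robust DISCRETE SSB in gapless magnets — not
U(1)); all 54 Theses files of the sub and all 44 open cards read: no route uses negative type /
Hadamard powers / a log-kernel, the only card is the spine card realised here.
Nearest prior art found: KLS1988PRL / KuboKishi1988 / doi:10.1007/bf01042599 (same infrared input,
LINEAR sum-rule closure with threshold); Bhatia2006 + Schoenberg1938 (ID kernels, pure math  [refs: 10.1007/bf01042599, 10.1007/b128444, 2410.00810, 2603.13212, doi:10.1007/bf01042599, doi:10.1007/b128444, LSSY2005, KuboKishi1988, Bhatia2006, Schoenberg1938]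

Barriers (technique_class: levy-khintchine, log-bootstrap, effective-boson): - technique_class: levy-khintchine, log-bootstrap, effective-boson
- Literature.Barriers.HubbardSuperconductivity.LROForcesLowLyingStates: evaded on the bosonic tier —
continuity is used only at FIXED finite M (Perron–Frobenius uniqueness, analyticity in Δ of one
sector block), the forbidden value is M-uniform, no gap / anomalous average / openness-of-order is
asserted and the Koma–Tasaki tower (other sectors) is never touched; met on the fermionic tier
exactly where the sibling routes meet it (DressHalfFilled's gapless dressing, Continuation) — the
shared bet.
- Literature.Barriers.HubbardSuperconductivity.HohenbergMerminWagnerPairing: not met — T = 0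
throughout; inside the formalism the T>0 d=2 obstruction is visible as |ν| = ∞ (ν_k ~ T/(ρ_s k²)).
- Literature.Barriers.HubbardSuperconductivity.PositiveTemperatureNoPairLRO: not met (ground states
only; no descent from a Gibbs state).
- Literature.Barriers.HubbardSuperconductivity.StrongCouplingCeiling: not in class — no t/U or
high-temperature expansion; U sits in the plaquette pair-binding window and enters only through the
certified lock-in Δ_eff(U) and Schrieffer–Wolff at second order in t' (finite-order operator
identity).
- Literature.Barriers.HubbardSuperconductivity.WeakCouplingCeiling: not in class — nothing is
expanded in U; the bosonic engine is non-perturbative.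
- Literature.Barriers.HubbardSuperconductivity.PerturbativeInvisibilityOfPairing: not met — no
asymptotic series in U is read.
- Literature.Barriers.Hubba

History (route lifecycle, newest last):
- 2026-08-26T09:38:07Z · DORMANT — reconciler: no traction for 8.4 d (last activity item-evidence-added at 2026-08-17T23:17:33Z); parked, not closed — `ledger route dormant route-HubbardSupercond (operator:999:916419)

sub-problem: HubbardSuperconductivity · status: dormant · opened planner-plan-novel-HubbardSuperconductivity-Hub-0943e37c-0 2026-08-16T13:45:22Z · rev 0 · ledger route-HubbardSuperconductivity-LevyLogBootstrap
GENERATED by the gate from the ledger (D-0016/17). Provers cite these decls: `theorem foo : Summit.HubbardSuperconductivity.HubbardSuperconductivity.Theses.LevyLogBootstrap.<Decl> := …` in Summits/HubbardSuperconductivity/HubbardSuperconductivity/Theorems/<Name>.lean.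
-/

namespace Summit.HubbardSuperconductivity.HubbardSuperconductivity.Theses.LevyLogBootstrap

open scoped BigOperators Topology Manifold Classical MeasureTheory ProbabilityTheory Matrix InnerProductSpace ComplexConjugate ContinuousMap
open Filter Set Function TopologicalSpace MeasureTheory

attribute [summit_statement] _root_.HubbardSuperconductivity

open Literature.Hubbard

/-- item stmt-HubbardSuperconductivity-15048 · crux · rank 2 · open · by planner
why it might fail: No positivity principle for the LOG of a ground-state correlation is known beyond single axes (RP ⇒ axis-ID only); a ringing harmonic not killed by 2×2 blocks (e.g. (π/2,π/2) structure near the AF point Δ→−1) could appear beyond 24 sites; literal all-M form tested only on 4×4 (all fillings) and 6×4.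
sources: Schoenberg1938, Bhatia2006, BergChristensenRessel1984, doi:10.1103/physrevb.48.3264, KLS1988PRL, idea:HubbardSuperconductivity/HubbardSuperconductivity/levy-mass-log-bootstrap
[crux] (card K1, block form) for every even M ≥ 4, every Δ ∈ [−1,0] and every normalised S^z_tot = 0
sector ground state ψ of H_M(Δ), the 2×2-block transverse kernel K₂ (written as the M²×M² matrix
(x,y) ↦ Σ_{x'∈block(x), y'∈block(y)} Re⟨ψ,S⁺_{x'}S⁻_{y'}ψ⟩, block(x) = (⌊x₀/2⌋,⌊x₁/2⌋); its PSD/ID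
properties equal those of the coarse (M/2)²-matrix) has every fractional Hadamard power (entrywise t
↦ t^s, s ∈ (0,1]) positive semidefinite — infinite divisibility; entries are > 0 by
Perron–Frobenius, so real powers are genuine. [difficulty: open-problem] -/
@[route_item "route-HubbardSuperconductivity-LevyLogBootstrap", crux]
def Block2InfDivXXZ : Prop :=
  ∀ (M : ℕ) [NeZero M], Even M → 4 ≤ M → ∀ Δ ∈ Set.Icc (-1:ℝ) 0, ∀ (ψ : Literature.MathematicalPhysics.QuantumLattice.TensorIndex (Literature.Probability.LatticeModels.TorusSite 2 M) 2 → ℂ), ψ ∈ Literature.MathematicalPhysics.QuantumLattice.spinZSector (Λ := Literature.Probability.LatticeModels.TorusSite 2 M) 1 0 → star ψ ⬝ᵥ ψ = 1 → Matrix.mulVec (Literature.MathematicalPhysics.QuantumLattice.xxzHamiltonian 1 (Literature.Probability.LatticeModels.torusGraph 2 M) (-1) Δ) ψ = ((Literature.MathematicalPhysics.QuantumLattice.lowestEnergyInSector 1 (Literature.MathematicalPhysics.QuantumLattice.xxzHamiltonian 1 (Literature.Probability.LatticeModels.torusGraph 2 M) (-1) Δ) 0 : ℝ) : ℂ) • ψ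 → ∀ s : ℝ, 0 < s → s ≤ 1 → (Matrix.of fun (x y : Literature.Probability.LatticeModels.TorusSite 2 M) => (∑ x' : Literature.Probability.LatticeModels.TorusSite 2 M, ∑ y' : Literature.Probability.LatticeModels.TorusSite 2 M, if (∀ i : Fin 2, (x' i).val / 2 = (x i).val / 2) ∧ (∀ i : Fin 2, (y' i).val / 2 = (y i).val / 2) then (star ψ ⬝ᵥ Matrix.mulVec (Literature.MathematicalPhysics.QuantumLattice.onSite x' (Literature.MathematicalPhysics.QuantumLattice.spinRaise 1) * Literature.MathematicalPhysics.QuantumLattice.onSite y' (Literature.MathematicalPhysics.QuantumLattice.spinLower 1)) ψ).re else 0) ^ s).PosSemidef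

/-- item stmt-HubbardSuperconductivity-15049 · crux · rank 3 · open · by planner
why it might fail: Constants: the card's ED budget at the KLS point closes only marginally for b=2 (≈0.9<1; b=4 comfortably) and Φ₂(Δ), B(Δ) degrade toward Δ→−1, so b=2 may not close near Δ_eff≈−0.99 (then restate on 4×4 blocks); input (c), pointwise order at the XY point, is expected (RP monotonicity) but unprinted.
sources: KLS1988PRL, KLS1988JSP, DysonLiebSimon1978, KuboKishi1988, doi:10.1007/bf01042599, doi:10.1007/b128444
[crux] (card K2 in implication form) Block2InfDivXXZ ⇒ HalfFilledOrder: block infinite divisibility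
on [−1,0] transports the planar order of the KLS point Δ = 0 to every Δ ∈ (−1,0] by the
log-bootstrap |ν| ≤ U_κ + β_κe^{|ν|} — inputs: (a) Gaussian-domination infrared bound K̂₂(k) ≤
B/|k|, 0<|k|<κ, for 2-block transverse fields uniformly on Δ ∈ [−1,0] (RP side: after the sublattice
π-rotation all three couplings are antiferromagnetic); (b) L-uniform lower bounds on n.n. block
transverse correlations (local; energy per bond); (c) a POINTWISE planar-order anchor min_X K₂(X) ≥
c₀ at Δ = 0 uniformly in M; (d) β_κe^{U_κ+1} < 1 for some κ; then fixed-M continuity (unique GS,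
analytic in Δ) and the forbidden gap give f(Δ) ≥ e^{−U_κ−1}, i.e. ⟨S⁺_totS⁻_tot⟩ ≥
(e^{−U_κ−1}/8)·M⁴. [deps: Block2InfDivXXZ] [difficulty: XL] -/
@[route_item "route-HubbardSuperconductivity-LevyLogBootstrap", crux]
def LevyTransport : Prop :=
  Block2InfDivXXZ → (∀ Δ ∈ Set.Ioc (-1:ℝ) 0, ∃ c : ℝ, 0 < c ∧ ∃ M₀ : ℕ, ∀ (M : ℕ) [NeZero M], Even M → M₀ ≤ M → ∀ (ψ : Literature.MathematicalPhysics.QuantumLattice.TensorIndex (Literature.Probability.LatticeModels.TorusSite 2 M) 2 → ℂ), ψ ∈ Literature.MathematicalPhysics.QuantumLattice.spinZSector (Λ := Literature.Probability.LatticeModels.TorusSite 2 M) 1 0 → star ψ ⬝ᵥ ψ = 1 → Matrix.mulVec (Literature.MathematicalPhysics.QuantumLattice.xxzHamiltonian 1 (Literature.Probability.LatticeModels.torusGraph 2 M) (-1) Δ) ψ = ((Literature.MathematicalPhysics.QuantumLattice.lowestEnergyInSector 1 (Literature.MathematicalPhysics.QuantumLattice.xxzHamiltonian 1 (Literature.Probability.LatticeModels.torusGraph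 2 M) (-1) Δ) 0 : ℝ) : ℂ) • ψ → c * (M : ℝ) ^ 4 ≤ (star ψ ⬝ᵥ Matrix.mulVec ((∑ x : Literature.Probability.LatticeModels.TorusSite 2 M, Literature.MathematicalPhysics.QuantumLattice.onSite x (Literature.MathematicalPhysics.QuantumLattice.spinRaise 1)) * (∑ y : Literature.Probability.LatticeModels.TorusSite 2 M, Literature.MathematicalPhysics.QuantumLattice.onSite y (Literature.MathematicalPhysics.QuantumLattice.spinLower 1))) ψ).re)

/-- item stmt-HubbardSuperconductivity-8148 · crux · rank 4 · open · by planner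
why it might fail: Needs a U with CERTIFIED Δ_eff(U) = −V/2J ∈ (−1,0] (YTK: V/J<2 only for U<U_s≈2.7; card ED −0.986…−0.993, 1% from the first-order d-CDW point); then gapless U(1) order of H_XXZ(Δ_eff) must survive the O(t')-relative Schrieffer–Wolff remainder uniformly in L — stability known for gapped phases only.
sources: YaoTsaiKivelson2007, TsaiKivelson2006, doi:10.1103/physrevb.65.104508, BravyiHastingsMichalakis2010, AizenmanEtAl2004, KLS1988PRL
[crux] DRESSING LEMMA at boson half filling, implication form (the fermionic half of
PlaquetteBoson's PbAnchorOrder with its bosonic input made an explicit hypothesis): HalfFilledOrder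
(planar order ≥ c(Δ)M⁴ of every half-filled sector GS of H_M(Δ), eventually in even M, for EVERY Δ ∈
(-1,0]) → AnchorOrder (∃ U > 0, δ ∈ (0,1/2), t₀ > 0: for t' ∈ (0,t₀), eventually in L ∈ 4ℕ, every
normalised (N_L,0)-sector GS of the checkerboard torus hamiltonian(G_intra,1,U) +
hamiltonian(G_inter,t',0), N_L = 2⌊(1-δ)L²/2⌋, has Re⟨Δ_d†Δ_d⟩ ≥ c(t')L⁴). Intended proof: pick U₀
in the pair-binding window with certified Δ_eff(U₀) = -v(U₀)/2j(U₀) ∈ (-1,0] (ED: U₀ ∈ [1,2]) and δ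
= 1/4 (hole pairs = half-filled hard-core bosons on the (L/2)-torus, no monotone depletion needed);
second-order Schrieffer–Wolff H_L(t',U₀) = t'²j·H_{L/2}(Δ_eff) ⊕ high + O(t'³); instantiate the
hypothesis at Δ_eff; show the order survives the U(1)-symmetric non-RP remainder and projects onto
Δ_d with O(1) overlap (B1g pair wavefunction of the plaquette). [difficulty: XL] -/
@[route_item "route-HubbardSuperconductivity-LevyLogBootstrap", crux]
def DressHalfFilled : Prop :=
  (∀ Δ ∈ Set.Ioc (-1:ℝ) 0, ∃ c : ℝ, 0 < c ∧ ∃ M₀ : ℕ, ∀ (M : ℕ) [NeZero M], Even M → M₀ ≤ M → ∀ (ψ : Literature.MathematicalPhysics.QuantumLattice.TensorIndex (Literature.Probability.LatticeModels.TorusSite 2 M) 2 → ℂ), ψ ∈ Literature.MathematicalPhysics.QuantumLattice.spinZSector (Λ := Literature.Probability.LatticeModels.TorusSite 2 M) 1 0 → star ψ ⬝ᵥ ψ = 1 → Matrix.mulVec (Literature.MathematicalPhysics.QuantumLattice.xxzHamiltonian 1 (Literature.Probability.LatticeModels.torusGraph 2 M) (-1) Δ) ψ = ((Literature.MathematicalPhysics.QuantumLattice.lowestEnergyInSector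 1 (Literature.MathematicalPhysics.QuantumLattice.xxzHamiltonian 1 (Literature.Probability.LatticeModels.torusGraph 2 M) (-1) Δ) 0 : ℝ) : ℂ) • ψ → c * (M : ℝ) ^ 4 ≤ (star ψ ⬝ᵥ Matrix.mulVec ((∑ x : Literature.Probability.LatticeModels.TorusSite 2 M, Literature.MathematicalPhysics.QuantumLattice.onSite x (Literature.MathematicalPhysics.QuantumLattice.spinRaise 1)) * (∑ y : Literature.Probability.LatticeModels.TorusSite 2 M, Literature.MathematicalPhysics.QuantumLattice.onSite y (Literature.MathematicalPhysics.QuantumLattice.spinLower 1))) ψ).re) → (∃ U : ℝ, 0 < U ∧ ∃ δ ∈ Set.Ioo (0:ℝ) (1/2), ∃ t₀ : ℝ, 0 < t₀ ∧ ∀ t' ∈ Set.Ioo (0:ℝ) t₀, ∃ c : ℝ, 0 < c ∧ ∃ L₀ : ℕ, ∀ (L : ℕ) [NeZero L], L₀ ≤ L → 4 ∣ L → ∀ (N : ℕ) (ψ : Literature.MathematicalPhysics.QuantumLattice.Fock (Literature.MathematicalPhysics.QuantumLattice.Orb (Literature.MathematicalPhysics.QuantumLattice.FermionTorus 2 L))),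 N = 2 * ⌊(1 - δ) * (L : ℝ) ^ 2 / 2⌋₊ → star ψ ⬝ᵥ ψ = 1 → Literature.MathematicalPhysics.QuantumLattice.IsGroundStateInSector (Literature.MathematicalPhysics.QuantumLattice.hamiltonian ((Literature.MathematicalPhysics.QuantumLattice.fermionTorusGraph 2 L) \ SimpleGraph.comap (fun x : Literature.MathematicalPhysics.QuantumLattice.FermionTorus 2 L => fun i : Fin 2 => ((ofLex x) i : ℕ) / 2) ⊤) 1 U + Literature.MathematicalPhysics.QuantumLattice.hamiltonian ((Literature.MathematicalPhysics.QuantumLattice.fermionTorusGraph 2 L) ⊓ SimpleGraph.comap (fun x : Literature.MathematicalPhysics.QuantumLattice.FermionTorus 2 L => fun i : Fin 2 => ((ofLex x) i : ℕ) / 2) ⊤) t' 0) N 0 ψ → c * (L : ℝ) ^ 4 ≤ (Literature.MathematicalPhysics.QuantumLattice.expect ((Literature.MathematicalPhysics.QuantumLattice.pairField Literature.MathematicalPhysics.QuantumLattice.dWaveFormFactor L)ᴴ * Literature.MathematicalPhysics.QuantumLattice.pairField Literature.MathematicalPhysics.QuantumLattice.dWaveFormFactor L) ψ).re)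

/-- item stmt-HubbardSuperconductivity-0907 · crux · rank 5 · open · by planner
why it might fail: ∀(U,δ) implication with no tool (no continuity of GS order in t'∈(0,1]); expected FALSE where small-t' pair order exists but the uniform GS is not d_{x²−y²}: U≤4, δ>0.4 (d_xy/p, DengEtAl2015), U≈6–8, δ≈1/8 (stripes, QinEtAl2020); first-order d-CDW/PS on the t' path near U_s≈2.7.
sources: DengEtAl2015, QinEtAl2020, YaoTsaiKivelson2007, doi:10.1103/physrevb.83.054508
[crux] CONTINUATION t' → 1 (the bet A4 of plaquette-boson-kls-anchor, typed as an implication so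
that the Assembly is pure logic): for all U > 0, δ ∈ (0,1/2): [anchor-type every-GS d-wave order
⟨Δ_d†Δ_d⟩ ≥ c(t')L⁴ on L ∈ 4ℕ tori for all t' ∈ (0,t₀)] ⇒ [the summit's conclusion at (U,δ): every
HYP-admissible ground-state sequence of hubbardTorus 2 L 1 U (= H_L(1,U)) has HasLongRangeOrder of
torusPullback (pairFieldCorr dWaveFormFactor ψ) along even sides]. Content: no quantum phase
transition in t' at fixed (U,δ), plus removal of the L ≡ 0 mod 4 artefact at the uniform point
(where no plaquette structure remains) and the pointwise-to-liminf bookkeeping (expect(Δ_d†Δ_d) =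
Σ_{x,y} pairFieldCorr, `expect_pairField_conjTranspose_mul`). Tool-less today like every
continuation; handles: δ is free (pick it away from 1/8-type commensurabilities and inside the DCA
dome), Rellich/Kato continuation of the B1g pair susceptibility protected by a twist-gap lower bound
(card twist-gap-protects-condensate), and numerics FIRST (t'-scan of the d-wave order by
DCA/CDMFT/DMRG at the chosen (U,δ)). A refutation here closes the route but leaves
PbAnchorOrder/PbMonotoneDepletion/PbHalfFilledXYOrder as Lite -/
@[route_item "route-HubbardSuperconductivity-LevyLogBootstrap", crux]
def Continuation : Prop :=
  ∀ (U δ : ℝ), 0 < U → δ ∈ Set.Ioo (0:ℝ) (1/2) → (∃ t₀ : ℝ, 0 < t₀ ∧ ∀ t' ∈ Set.Ioo (0:ℝ) t₀, ∃ c : ℝ, 0 < c ∧ ∃ L₀ : ℕ, ∀ (L : ℕ) [NeZero L], L₀ ≤ L → 4 ∣ L → ∀ (N : ℕ) (ψ : Literature.MathematicalPhysics.QuantumLattice.Fock (Literature.MathematicalPhysics.QuantumLattice.Orb (Literature.MathematicalPhysics.QuantumLattice.FermionTorus 2 L))), N = 2 * ⌊(1 - δ) * (L : ℝ) ^ 2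 / 2⌋₊ → star ψ ⬝ᵥ ψ = 1 → Literature.MathematicalPhysics.QuantumLattice.IsGroundStateInSector (Literature.MathematicalPhysics.QuantumLattice.hamiltonian ((Literature.MathematicalPhysics.QuantumLattice.fermionTorusGraph 2 L) \ SimpleGraph.comap (fun x : Literature.MathematicalPhysics.QuantumLattice.FermionTorus 2 L => fun i : Fin 2 => ((ofLex x) i : ℕ) / 2) ⊤) 1 U + Literature.MathematicalPhysics.QuantumLattice.hamiltonian ((Literature.MathematicalPhysics.QuantumLattice.fermionTorusGraph 2 L) ⊓ SimpleGraph.comap (fun x : Literature.MathematicalPhysics.QuantumLattice.FermionTorus 2 L => fun i : Fin 2 => ((ofLex x) i : ℕ) / 2) ⊤) t' 0) N 0 ψ → c * (L : ℝ) ^ 4 ≤ (Literature.MathematicalPhysics.QuantumLattice.expect ((Literature.MathematicalPhysics.QuantumLattice.pairField Literature.MathematicalPhysics.QuantumLattice.dWaveFormFactor L)ᴴ * Literature.MathematicalPhysics.QuantumLattice.pairField Literature.MathematicalPhysics.QuantumLattice.dWaveFormFactor L) ψ).re) → ∀ (N : ℕ → ℕ) (ψ : ∀ L, Literature.MathematicalPhysics.QuantumLattice.Fock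 (Literature.MathematicalPhysics.QuantumLattice.Orb (Literature.MathematicalPhysics.QuantumLattice.FermionTorus 2 L))), (∀ L, Even L → N L = 2 * ⌊(1 - δ) * (L : ℝ) ^ 2 / 2⌋₊ ∧ star (ψ L) ⬝ᵥ ψ L = 1 ∧ Literature.MathematicalPhysics.QuantumLattice.IsGroundStateInSector (Literature.MathematicalPhysics.QuantumLattice.hubbardTorus 2 L 1 U) (N L) 0 (ψ L)) → Literature.Probability.LatticeModels.HasLongRangeOrder (fun k => Literature.Probability.LatticeModels.halfOpenBox 2 (2 * k)) (fun k => Literature.MathematicalPhysics.QuantumLattice.torusPullback (Literature.MathematicalPhysics.QuantumLattice.pairFieldCorr Literature.MathematicalPhysics.QuantumLattice.dWaveFormFactor ψ) (2 * k))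

/-- item stmt-HubbardSuperconductivity-0906 · support · rank 9 · open · by planner
sources: KLS1988PRL, KuboKishi1988, doi:10.1007/bf01042599
[crux] HALF-FILLED XY ORDER of the S=½ ferro-XY/AF-Ising torus model on the whole easy-plane
interval Δ ∈ (−1,0] (input (A) of monotone depletion; engine = card uv-ir-handshake-lp-kls): every
normalised S^z_tot = 0 ground state ψ of `xxzHamiltonian 1 (torusGraph 2 M) (-1) Δ` on large even
tori has ⟨ψ, S⁺_tot S⁻_tot ψ⟩ ≥ c(Δ)·M⁴. KNOWN: |Δ| ≲ 0.2 by reflection positivity + Gaussian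
domination + the KLS T=0 sum-rule closure (Kennedy–Lieb–Shastry 1988, Kubo–Kishi 1988; tree:
kls_xy_infraredBound_ground_holds, kennedy_lieb_shastry_xy_ground at Δ = 0 for the tracial
ground-state functional — the S^z=0-sector form here needs the sector identification, routine by
Perron–Frobenius). NEEDED by the route: Δ = Δ_eff(U) ≈ −0.99 (0.7–1.4 % on the easy-plane side of
the Heisenberg point, where xy order is physically healthy, m ≈ 0.3, but the IR-bound closure has
O(1) slack). PROPOSED ENGINE: the linear programme over the structure factor g(k) ≥ 0 with rows {KLS
infrared bound g(k) ≤ B_e(k), sum rule, SDP-certified two-sided intervals for the short-range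
correlators C(r), |r| ≤ R (Wang et al. PRX 2024; symmetry bootstrap arXiv:2410.00810)}, monotone in
R with KLS as the R = 0 vertex, dual = an ex -/
@[route_item "route-HubbardSuperconductivity-LevyLogBootstrap"]
def HalfFilledOrder : Prop :=
  ∀ Δ ∈ Set.Ioc (-1:ℝ) 0, ∃ c : ℝ, 0 < c ∧ ∃ M₀ : ℕ, ∀ (M : ℕ) [NeZero M], Even M → M₀ ≤ M → ∀ (ψ : Literature.MathematicalPhysics.QuantumLattice.TensorIndex (Literature.Probability.LatticeModels.TorusSite 2 M) 2 → ℂ), ψ ∈ Literature.MathematicalPhysics.QuantumLattice.spinZSector (Λ := Literature.Probability.LatticeModels.TorusSite 2 M) 1 0 → star ψ ⬝ᵥ ψ = 1 → Matrix.mulVec (Literature.MathematicalPhysics.QuantumLattice.xxzHamiltonian 1 (Literature.Probability.LatticeModels.torusGraph 2 M) (-1) Δ) ψ = ((Literature.MathematicalPhysics.QuantumLattice.lowestEnergyInSector 1 (Literature.MathematicalPhysics.QuantumLattice.xxzHamiltonian 1 (Literature.Probability.LatticeModels.torusGraph 2 M) (-1) Δ) 0 : ℝ) : ℂ) • ψ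 → c * (M : ℝ) ^ 4 ≤ (star ψ ⬝ᵥ Matrix.mulVec ((∑ x : Literature.Probability.LatticeModels.TorusSite 2 M, Literature.MathematicalPhysics.QuantumLattice.onSite x (Literature.MathematicalPhysics.QuantumLattice.spinRaise 1)) * (∑ y : Literature.Probability.LatticeModels.TorusSite 2 M, Literature.MathematicalPhysics.QuantumLattice.onSite y (Literature.MathematicalPhysics.QuantumLattice.spinLower 1))) ψ).re

/-- item stmt-HubbardSuperconductivity-15050 · support · rank 9 · closed · proved by Summit.HubbardSuperconductivity.HubbardSuperconductivity.Theorems.LevyLogBootstrap.levyJensenFloor_proof @ 8f351f631032 (prover) · by planner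
sources: BergChristensenRessel1984, Bhatia2006, idea:HubbardSuperconductivity/HubbardSuperconductivity/levy-mass-log-bootstrap
[support] (card P1, the ν-free "take logarithms" floor; provable now by weighted AM–GM / convexity
of exp) for every M and every entrywise-positive function k on the torus (ℤ/Mℤ)²: exp(−M⁻²Σ_X
log(k(0)/k(X))) ≤ (Σ_X k(X))/(M²·k(0)) — "condensate fraction ≥ e^{−Lévy mass}"; the wing and
UV-mass bounds (which need ν ≥ 0) ride later with --supports LevyTransport. [difficulty:
provable-now] -/
@[route_item "route-HubbardSuperconductivity-LevyLogBootstrap"]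
def LevyJensenFloor : Prop :=
  ∀ (M : ℕ) [NeZero M] (k : Literature.Probability.LatticeModels.TorusSite 2 M → ℝ), (∀ X, 0 < k X) → Real.exp (-(∑ X, Real.log (k 0 / k X)) / (M : ℝ) ^ 2) ≤ (∑ X, k X) / ((M : ℝ) ^ 2 * k 0)

-- `LevyJensenFloor` holds: proved by `Summit.HubbardSuperconductivity.HubbardSuperconductivity.Theorems.LevyLogBootstrap.levyJensenFloor_proof` @ 8f351f631032 (its module imports this route file, so no `_holds` link can be stated here).

/-- item stmt-HubbardSuperconductivity-15051 · assembly · rank 1 · closed · proved by Summit.HubbardSuperconductivity.HubbardSuperconductivity.Theorems.LevyLogBootstrap.assembly_proof @ ede594965fdf (prover) · by planner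
sources: KLS1988PRL, YaoTsaiKivelson2007, Scalapino1995
[assembly] Block2InfDivXXZ → LevyTransport → DressHalfFilled → Continuation →
HubbardSuperconductivity. -/
@[route_item "route-HubbardSuperconductivity-LevyLogBootstrap"]
def Assembly : Prop :=
  Block2InfDivXXZ → LevyTransport → DressHalfFilled → Continuation → HubbardSuperconductivity

-- `Assembly` holds: proved by `Summit.HubbardSuperconductivity.HubbardSuperconductivity.Theorems.LevyLogBootstrap.assembly_proof` @ ede594965fdf (its module imports this route file, so no `_holds` link can be stated here).

/-! D-0027 §2.1 — DECIDING THEOREM (planner-authored via `route open/edit --closes-file`; by planner-plan-novel-HubbardSuperconductivity-Hub-0943e37c-0 2026-08-16T13:45:22Z):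
its hypotheses are this route's items and its conclusion the sub-problem Statement (glue_lint), and it elaborates with this file. -/

@[closes "route-HubbardSuperconductivity-LevyLogBootstrap"] theorem closes (h1 : Block2InfDivXXZ) (h2 : LevyTransport) (h3 : DressHalfFilled) (h4 : Continuation) : _root_.HubbardSuperconductivity := by
  obtain ⟨U, hU, δ, hδ, h⟩ := h3 (h2 h1)
  exact ⟨U, hU, δ, hδ, fun N ψ hyp => h4 U δ hU hδ h N ψ hyp⟩

end Summit.HubbardSuperconductivity.HubbardSuperconductivity.Theses.LevyLogBootstrap
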